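import Literature.Computability.Cryptography.HallgrenPellQuantum
import HarnessLib

/-!
# Hallgren's regulator algorithm over an abstract infrastructure, III: adequacy of the walk parameters

Topic `Computability/Cryptography`; companion of `HallgrenRegulatorGenericSampling.lean` (I–II) and
`HallgrenRegulatorGenericPost.lean` (III–IV): the numeric side conditions of the generic regulator theorem
(the hypotheses `2K+1 ≤ d̂(I₀)`, `Res < M(L − 2η)`, `N(E_tot + 2η) ≤ 2`, `5000 ≤ NR`, `3(NR)² ≤ Q`,
`51 n + 7 ≤ 3NR/4` of `HallgrenPellQuantum`-style assemblies) for ANY `GiantStepCycle` `G` whose few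
numeric invariants are dominated by the tree's parameter functions of the input length `n`
(`HallgrenShiftParams.lean`: `aN, LQ, Kb, Gb, s0, Tdbl, Mfin, precP`). These are the inequalities of
Jozsa 2003, §9 (proof of Thm. 5) and §10 (proof of Thm. 6), proved there for the principal cycle of a
real quadratic order (`HallgrenPellQuantum.start_ge`, `Res_lt_M`, `N_mul_Etot_le`, `S_ge`,
`three_S_sq_le_Q`, `card_goodStarts_ge_quarter`) and stated here with the cycle abstract, so that other
infrastructures of unit rank one (Buchmann–Williams 1988) can reuse the assembly verbatim:

* `log_eleven_tenths_ge` (`ln(11/10) ≥ 1/11`), `Kb_ge_linear` (`10n + 66 ≤ Kb n`);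
* `start_ge_gen`, `Res_lt_M_gen` (from `4K + 2 ≤ Kb n`, `4G + 8 ≤ Gb n`, `L − 2η ≥ 1/12`);
* `N_mul_Etot_le_gen` (from `η 2^{prec(n)} ≤ 16`, `n ≥ 6`, through `prec_key`);
* `S_ge_gen`, `three_S_sq_le_Q_gen`, `n51_le_gen` (from `ln 2/6 ≤ R ≤ 2^{2n+8}`, `n_G ln 2 ≤ 6R`).

Theorem-only file, no named facts, no definitions.

## References

* R. Jozsa, *Notes on Hallgren's efficient quantum algorithm for solving Pell's equation*,
  arXiv:quant-ph/0302134 (2003), §9 (proof of Thm. 5), §10 Prop. 36, Thm. 6. [Jozsa2003]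
* J. Buchmann, H. C. Williams, *On the infrastructure of the principal ideal class of an algebraic
  number field of unit rank one*, Math. Comp. 50 (1988), §3–§4. [BuchmannWilliams1988Infrastructure]
-/

noncomputable section

namespace Literature.Computability.Cryptography

namespace HallgrenQuantum

open WalkData

/-! ### Two constants -/

/-- `ln(11/10) ≥ 1/11` (`ln x ≥ 1 − 1/x`). [folklore] -/
theorem log_eleven_tenths_ge : (1 : ℝ) / 11 ≤ Real.log (11 / 10) := by
  have h := Real.one_sub_inv_le_log_of_pos (show (0 : ℝ) < 11 / 10 by norm_num)
  norm_num at h ⊢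
  linarith

/-- `Kb n ≥ 10 n + 66`. [folklore] -/
theorem Kb_ge_linear (n : ℕ) : 10 * n + 66 ≤ Kb n := by
  unfold Kb; nlinarith [Nat.zero_le n]

/-! ### The walk parameters -/

section Walk

variable {ι : Type*} (G : GiantStepCycle ι) (n : ℕ)

/-- **The start-up freezes** (`2K + 1 ≤ d̂(I₀)` after `s₀ = 12 Kb + 6` rounds) as soon as `4K + 2 ≤ Kb n`
and `L − 2η ≥ 1/12`. [cite: Jozsa2003, §9 (proof of Thm. 5)] -/
theorem start_ge_gen (hK : 4 * (G.K : ℝ) + 2 ≤ Kb n) (hL : (1 : ℝ) / 12 ≤ G.L - 2 * G.η) :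
    2 * G.K + 1 ≤ (G.start (s0 n)).2 := by
  refine G.le_start (j := 6 * Kb n + 3) ?_ (by unfold s0; omega)
  have hj : ((6 * Kb n + 3 : ℕ) : ℝ) = 6 * (Kb n : ℝ) + 3 := by push_cast; ring
  rw [hj]
  have hK0 := G.K_nonneg
  have h1 : (6 * (Kb n : ℝ) + 3) * (1 / 12) ≤ (6 * (Kb n : ℝ) + 3) * (G.L - 2 * G.η) :=
    mul_le_mul_of_nonneg_left hL (by positivity)
  linarith

/-- **The final rounds are adequate**: `Res < M (L − 2η)` as soon as `4K + 2 ≤ Kb n`, `4G + 8 ≤ Gb n`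
and `L − 2η ≥ 1/12` (`M = Mfin n = 3 ResB n`). [cite: Jozsa2003, §9 (proof of Thm. 5)] -/
theorem Res_lt_M_gen (hK : 4 * (G.K : ℝ) + 2 ≤ Kb n) (hGG : 4 * G.G + 8 ≤ Gb n)
    (hL : (1 : ℝ) / 12 ≤ G.L - 2 * G.η) :
    G.Res (s0 n) (Tdbl n) < Mfin n * (G.L - 2 * G.η) := by
  have hRes := G.Res_le (s0 n) (Tdbl n)
  have hK0 := G.K_nonneg
  have hη0 := G.η_nonneg
  have hη8 := G.η_le
  have hM : ((Mfin n : ℕ) : ℝ) = 3 * ((2 * (Tdbl n : ℝ) + 3) * ((Kb n : ℝ) + 1) + Gb n + 1) := by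
    unfold Mfin ResB; push_cast; ring
  rw [hM]
  set T : ℝ := (Tdbl n : ℝ)
  set KB : ℝ := (Kb n : ℝ)
  set GB : ℝ := (Gb n : ℝ)
  have hT0 : (0 : ℝ) ≤ T := Nat.cast_nonneg _
  have hKB0 : (0 : ℝ) ≤ KB := Nat.cast_nonneg _
  have hGB0 : (0 : ℝ) ≤ GB := Nat.cast_nonneg _
  have h1 : 3 * ((2 * T + 3) * (KB + 1) + GB + 1) * (1 / 12) ≤ 3 * ((2 * T + 3) * (KB + 1) + GB + 1) * (G.L - 2 * G.η) :=
    mul_le_mul_of_nonneg_left hL (by positivity)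
  have hTK : T * (4 * G.K + 2) ≤ T * KB := mul_le_mul_of_nonneg_left hK hT0
  have hTη : T * G.η ≤ T * (1 / 8) := mul_le_mul_of_nonneg_left hη8 hT0
  nlinarith [hTK, hTη, hRes, h1]

/-- **The accumulated distance error is below `2/N`**: `N (E_tot + 2η) ≤ 2` as soon as `η 2^{prec(n)} ≤ 16` and
`n ≥ 6` (then `η ≤ (n + 10) 2^{−prec}`, and `prec_key` applies). [cite: Jozsa2003, §9 Thm. 5 (sufficient accuracy)] -/
theorem N_mul_Etot_le_gen (hη : G.η * 2 ^ precP n ≤ 16) (hn : 6 ≤ n) :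
    (Ngrid n : ℝ) * (G.Etot (s0 n) (Tdbl n) (2 * Mfin n) + 2 * G.η) ≤ 2 := by
  have hE := G.Etot_le (s0 n) (Tdbl n) (2 * Mfin n)
  have hη0 := G.η_nonneg
  have hP0 : (0 : ℝ) < 2 ^ precP n := by positivity
  have hη' : G.η ≤ ((n + 10 : ℕ) : ℝ) * (1 / 2) ^ precP n := by
    rw [one_div_pow, mul_one_div, le_div_iff₀ hP0]
    have : (16 : ℝ) ≤ ((n + 10 : ℕ) : ℝ) := by
      have : (16 : ℕ) ≤ n + 10 := by omega
      exact_mod_cast this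
    linarith
  have hkey := prec_key n
  have hkeyR : ((2 ^ aN n * (Tdbl n * 2 ^ Tdbl n * (s0 n + 1) + Tdbl n + 2 * Mfin n + 3) *
      (n + 10) : ℕ) : ℝ) ≤ ((2 * 2 ^ precP n : ℕ) : ℝ) := by exact_mod_cast hkey
  push_cast at hkeyR hE
  rw [Ngrid_real]
  have hEt : G.Etot (s0 n) (Tdbl n) (2 * Mfin n) + 2 * G.η ≤
      ((Tdbl n : ℝ) * 2 ^ Tdbl n * ((s0 n : ℝ) + 1) + Tdbl n + 2 * (Mfin n : ℝ) + 3) * G.η := by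
    linarith
  have hT0 : (0 : ℝ) ≤ Tdbl n := Nat.cast_nonneg _
  have hs0 : (0 : ℝ) ≤ s0 n := Nat.cast_nonneg _
  have hM0 : (0 : ℝ) ≤ Mfin n := Nat.cast_nonneg _
  have hP2 : (0 : ℝ) ≤ 2 ^ Tdbl n := pow_nonneg (by norm_num) _
  have hprod : (0 : ℝ) ≤ (Tdbl n : ℝ) * 2 ^ Tdbl n * ((s0 n : ℝ) + 1) :=
    mul_nonneg (mul_nonneg hT0 hP2) (by linarith)
  have hC0 : (0 : ℝ) ≤ (Tdbl n : ℝ) * 2 ^ Tdbl n * ((s0 n : ℝ) + 1) + Tdbl n + 2 * (Mfin n : ℝ) + 3 := by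
    linarith
  have hEt2 : G.Etot (s0 n) (Tdbl n) (2 * Mfin n) + 2 * G.η ≤
      ((Tdbl n : ℝ) * 2 ^ Tdbl n * ((s0 n : ℝ) + 1) + Tdbl n + 2 * (Mfin n : ℝ) + 3) *
        ((((n + 10 : ℕ)) : ℝ) * (1 / 2) ^ precP n) :=
    hEt.trans (mul_le_mul_of_nonneg_left hη' hC0)
  have hpow : (2 : ℝ) ^ precP n * (1 / 2) ^ precP n = 1 := by rw [← mul_pow]; norm_num
  have h2a : (0 : ℝ) ≤ 2 ^ aN n := pow_nonneg (by norm_num) _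
  have hhalf : (0 : ℝ) ≤ (1 / 2) ^ precP n := pow_nonneg (by norm_num) _
  calc (2 : ℝ) ^ aN n * (G.Etot (s0 n) (Tdbl n) (2 * Mfin n) + 2 * G.η)
      ≤ 2 ^ aN n * (((Tdbl n : ℝ) * 2 ^ Tdbl n * ((s0 n : ℝ) + 1) + Tdbl n + 2 * (Mfin n : ℝ) + 3) *
        ((((n + 10 : ℕ)) : ℝ) * (1 / 2) ^ precP n)) := mul_le_mul_of_nonneg_left hEt2 h2a
    _ = (2 ^ aN n * ((Tdbl n : ℝ) * 2 ^ Tdbl n * ((s0 n : ℝ) + 1) + Tdbl n + 2 * (Mfin n : ℝ) + 3) *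
        (((n + 10 : ℕ)) : ℝ)) * (1 / 2) ^ precP n := by ring
    _ ≤ (2 * 2 ^ precP n) * (1 / 2) ^ precP n := by
        apply mul_le_mul_of_nonneg_right _ hhalf
        push_cast
        linarith
    _ = 2 := by rw [mul_assoc, hpow, mul_one]

end Walk

/-! ### The size of the cycle -/

section Size

variable {ι : Type*} (G : GiantStepCycle ι) (n : ℕ)

/-- **`S = N R ≥ 5000`** as soon as `R ≥ ln 2 / 6` and `n ≥ 2` (`N = 2^{2n+12} ≥ 2^16`). [folklore] -/
theorem S_ge_gen (hR : Real.log 2 / 6 ≤ G.R) (hn : 2 ≤ n) : (5000 : ℝ) ≤ Ngrid n * G.R := by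
  have hl := Real.log_two_gt_d9
  have hN : (65536 : ℝ) ≤ Ngrid n := by
    rw [Ngrid_real, aN]
    calc (65536 : ℝ) = 2 ^ 16 := by norm_num
      _ ≤ 2 ^ (2 * n + 12) := pow_le_pow_right₀ (by norm_num) (by omega)
  have hR0 : (0.1155 : ℝ) ≤ G.R := by linarith
  nlinarith

/-- **`Q = 2^L ≥ 3 S²`** as soon as `0 ≤ R ≤ 2^{2n+8}` (`S = NR ≤ 2^{4n+20}`, `Q = 4 (2^{4n+20})²`).
[cite: Jozsa2003, §10 Thm. 6 (q ≥ 3S²)] -/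
theorem three_S_sq_le_Q_gen (hR0 : 0 ≤ G.R) (hR : G.R ≤ (2 : ℝ) ^ (2 * n + 8)) :
    3 * (Ngrid n * G.R) ^ 2 ≤ (2 : ℝ) ^ LQ n := by
  have hS : Ngrid n * G.R ≤ (2 : ℝ) ^ (4 * n + 20) := by
    rw [Ngrid_real, show 4 * n + 20 = aN n + (2 * n + 8) by unfold aN; ring, pow_add]
    exact mul_le_mul_of_nonneg_left hR (by positivity)
  have hS0 : 0 ≤ Ngrid n * G.R := by rw [Ngrid_real]; positivity
  have h1 : (Ngrid n * G.R) ^ 2 ≤ ((2 : ℝ) ^ (4 * n + 20)) ^ 2 := pow_le_pow_left₀ hS0 hS 2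
  have hL : (2 : ℝ) ^ LQ n = 4 * ((2 : ℝ) ^ (4 * n + 20)) ^ 2 := by
    rw [show LQ n = (4 * n + 20) + (4 * n + 20) + 2 by unfold LQ; ring, pow_add, pow_add]
    norm_num; ring
  rw [hL]
  nlinarith [pow_pos (show (0 : ℝ) < 2 ^ (4 * n + 20) by positivity) 2]

/-- **`51 n_G + 7 ≤ 3S/4`** (the hypothesis of Jozsa's counting lemma, `HallgrenCombCorrMass`) as soon as
`R ≥ ln 2 / 6` and the cycle has `n_G ≤ 6R / ln 2` ideals (`N ≥ 4096`). [cite: Jozsa2003, §10 Prop. 36 (iii)] -/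
theorem n51_le_gen (hR : Real.log 2 / 6 ≤ G.R) (hnR : (G.n : ℝ) * Real.log 2 ≤ 6 * G.R) :
    (51 : ℝ) * G.n + 7 ≤ 3 * ((Ngrid n : ℝ) * G.R) / 4 := by
  have hl := Real.log_two_gt_d9
  have hN := Ngrid_ge n
  have hR0 : 0 < G.R := by linarith
  have hGn : (G.n : ℝ) ≤ 9 * G.R := by
    by_contra hcon
    push Not at hcon
    have : 9 * G.R * Real.log 2 < (G.n : ℝ) * Real.log 2 := mul_lt_mul_of_pos_right hcon (by linarith)
    nlinarith
  have h1 : (51 : ℝ) * G.n + 7 ≤ 459 * G.R + 61 * G.R := by nlinarith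
  have h2 : (4096 : ℝ) * G.R ≤ Ngrid n * G.R := mul_le_mul_of_nonneg_right hN hR0.le
  linarith

end Size

end HallgrenQuantum

end Literature.Computability.Cryptography

end
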